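import Summits.Ventures.WeilGRH.UniformConductorFloorJointData640Log9
import HarnessLib

/-!
# GRH arm (rh-explicit, venture WeilGRH): kernel check — the FRAME of the R = 640 joint cell certificate `certEvenDvd3R640Log9` (t = log 3)

Cell `rh-explicit`, WEIL TRACK — GRH ARM (weil-grh-1, gen9).  `JointCert.checkFrame` (shape, `φ` bounds, shifts, the 703 exact slab masses against
`(639/640)^(a k)` by `Nat.pow`, the exact constant, `e^{2t} ≤ 10`) of `certEvenDvd3R640Log9` (`UniformConductorFloorJointData640Log9.lean`), by `decide +kernel` (≈ 40 s).
The 704 cell inequalities are checked in five range files `…JointR640Log9Dvd3Cells{A,B,C,D,E}.lean` (`cellsRange 0 176 / 176 176 / 352 176 / 528 88 / 616 88`: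
at `J = 704` a range of 176 cells starting at 528 exceeds the kernel's memory guard, 88 does not).  No definitions; no named facts; standard axioms. [folklore]
-/

namespace Summit.Ventures.WeilGRH

namespace UniformFloor

set_option maxHeartbeats 0 in
set_option maxRecDepth 200000 in
/-- The frame of `certEvenDvd3R640Log9` checks. [folklore] -/
theorem certEvenDvd3R640Log9_checkFrame : certEvenDvd3R640Log9.checkFrame = true := by
  decide +kernel

end UniformFloor

end Summit.Ventures.WeilGRH
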